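import Summits.BirchSwinnertonDyer.BirchSwinnertonDyer.Theorems.ErratumRoadFiveBdvCalibrationSplitDefs

/-!
# S1R sketch — the Γ₁/Γ₀ Petersson-index amendment of `bdvExplicitExponent` (idea-9 g51) — STATUS (rev 1.3): (α) CHOSEN by pen g52; body ALIGNED to the TOTIENT ruling

rev 1.3 (2026-08-31, critic V381 N1): pen g52 (`pub/bsd-stepL/STATUS.md` 2026-08-31T03:03:23Z) CHOSE (α) = S1R in the TOTIENT spelling
«`− (padicValNat p (Nat.totient N) : ℤ)` next to the KEPT Γ₀ pair, `N` = level binder of `f : CuspForm (Gamma0 N) 2`»; the body of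
`bdvExplicitExponentR` below is now written INLINE in exactly that shape (totient term right after the Γ₀ pair, before `− v`) —
token-for-token the body of `BdvCalibrationSplitNF.bdvExplicitExponentR` in NF Sketch rev 1.2 (`Lines/bdv_calibration_split_nf_Sketch.lean`
commit 8bd9acf6720d) — so the ONE tree definition (er5 F1 `…BdvCalibrationSplitR`/RDefs, typed by the LEAD; V381 N1) has a single
candidate body whichever sketch is copied; `petIndexVal` survives as an abbreviation (`bdvExplicitExponentR_eq_sub`).

**Status (memo rev 1.4, `Lines/bdv22_o4_erho_level.md`, 2026-08-31 ≈03:30Z; typer ty-snf g1 T0′ token 02:53:02Z,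
`pub/bsd-stepL/ty-snf/g1/T0PRIME-MEMO.md` sha16 1bb88813fff2ba2e): ONE OF THE TWO ADMISSIBLE SPELLINGS of the repair — adopt
EXACTLY ONE, pen's call, never both, and not in `perRatio`.**  Typer T0′ CONFIRMED (P-T0)′: BDV22's unit `A` carries the
Γ₁(N_f)-Petersson norm (KLZ17 Thm 2.7.4), i.e. `A = unit/ι_M` in T0's Γ₀-Petersson currency, ι_M = [Γ̄₀(M):Γ̄₁(M)] = φ(M)/2,
M = N_W/p, and that index is booked NOWHERE else — not in BDV's printed chain (no congruence number of f occurs in (1),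
(25)–(38), §4.4), not in T0's 𝔇, not in the typed frame (`congruenceNumber Dt.f : CuspForm (Gamma0 N)`, X₀ `modularDegree`,
X₀ symbol lattice `plusPeriod`).  So S1 `bdvExplicitExponent` AS TYPED books ι ZERO times and, with an f-blind `V`, is off by
`ν(W) = v_p φ(N_W) = v_p φ(M)` on `{W : p ∣ φ(N_W/p)}` (memo rev 1.4 §1 NET STATEMENT, (A6) period-invariance check, §5 (C2‴);
BSTW24 Prop 4.13(ii)+Thm 4.10+Rem 1.7 give the same count at good p: `A = unit/c̃^{Γ₁}_g`, `c̃_g ∼ ι_N·m^{X₀}`).  The two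
spellings: (α) THIS file — keep the Γ₀ pair and subtract `padicValNat p (Nat.totient N)`; (β) re-type `r_f` as the
Γ₁(N)-congruence number (needs one D-request `congruenceNumberGamma1` and the PRE fact
`padicValNat_gamma1CongruenceNumber_eq_X1Degree_of_ordN_le_one`).  (α) ⟺ (β) by the (Γ₁-ARS) dictionary at `p ∥ N`:
`ord_p η^{Γ₁(N)}(f) = ord_p r^{Γ₀}(f) + ν(W)` [Tilouine 1997 (CSS) Thm 3.4 + Cor. 1–3; ARS 2012 Thm 2.1 / Prop 5.9 (CGS on J₁);
BSTW24 Rem 1.7; Mazur 1978], `p ≥ 5`, Irr.  History: rev 1.0 of this file proposed (α); rev 1.1 labelled it «REJECTED OPTION»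
after memo revs 1.1–1.3 claimed a compensating Γ₁ congruence number inside BDV's chain — that claim is WITHDRAWN by its author
(memo e9: BSTW's p-unit coefficient holds for the QUOTIENT-lattice class `𝐳_{δ_g/c̃_g}`, Lemma 1.5(ii); the value-pinned class
carries `c̃_g`), so the rev-1.1 label is superseded.  The Lean below is unchanged since rev 1.0 (rc 0, no `sorry`).

Planner SKETCH for the pen / LEAD, companion to the desk memo
`Cruxes/EulerHalfNotRamNoInertSetAtFive/Lines/bdv22_o4_erho_level.md` rev 1.4, §5 (C2‴) spelling (α) (first proposed in rev 1.0, commit 3e0d4fceba2d, §5 (C2)).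
It is NOT a registered line (no `ledger skeleton check`; registries f297f72a3565a6d8 / a6e65636170da625 untouched),
contains no `sorry`, and proves nothing about any curve: it only TYPES the amended exponent and its bookkeeping.

Content.  BDV22's unit `A = L_p(f_α,g)/(L_p(f_α)L_p(f_α⊗ε_K))` ((30), p. 36–37) carries the Petersson norm on
`Γ₁(N_f)` (KLZ17 Thm 2.7.4; Urban 2014), while the frame books `Γ₀(N)` objects (`congruenceNumber` on `Gamma0 N`,
ARS Thm 2.1(b), `plusPeriod` of the `X₀(N)` symbol lattice).  The index `ι_N = [Γ₀(N) : ±Γ₁(N)] = φ(N)/2` therefore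
enters the crossing exponent once, as `ν(W) := v_p(φ(N_W))` (`p ≥ 5`):
`bdvExplicitExponentR … N := bdvExplicitExponent … − v_p(φ(N))`, equivalently `r_f` read as the `Γ₁(N)`-congruence
number `∼_p deg(X₁(N) → E)` (BSTW24 §1.2.3, Remark 1.7).  On the sub-class `p ∤ φ(N)` (no bad prime `q ≡ 1 (mod p)`)
the amendment is invisible (`bdvExplicitExponentR_eq_of_not_dvd`).  Orientation caveat: memo §6 (o4′-5).

Sources: [BDV22] Adv. Math. 398 (2022) 108172, §4 (30).  [KLZ17] Kings–Loeffler–Zerbes, Camb. J. Math. 5 (2017),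
Thm 2.7.4.  [Urban14] Urban, Nearly overconvergent modular forms, §4.4.  [BD14] Bertolini–Darmon, Israel J. Math. 199
(2014), (9), (21).  [BSTW24] arXiv:2409.01350, Lemma 1.6, Remark 1.7, Prop. 4.13, §4.3.3.  [ARS12] Agashe–Ribet–Stein,
Thm 2.1.  Typed ≠ proved; no summit statement is touched; BSD is proved for no curve.
-/

namespace Summit.BirchSwinnertonDyer.BirchSwinnertonDyer.Cruxes.EulerHalfNotRamNoInertSetAtFive.S1RSketch

open Summit.BirchSwinnertonDyer.BirchSwinnertonDyer.Theorems.ErratumRoadFiveBdvCalibrationSplit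

/-- `ν_p(N) := v_p(φ(N))` — the `p`-adic valuation of the Petersson index `[Γ₀(N) : ±Γ₁(N)] = φ(N)/2` (`p` odd). -/
def petIndexVal (p N : ℕ) : ℕ := padicValNat p (Nat.totient N)

/-- The amended explicit crossing exponent (S1R, option (α), pen g52's TOTIENT spelling): the registered `bdvExplicitExponent`
with `− v_p(φ(N))` inserted right after the Γ₀ pair `(ord_p r_f − ord_p m_f)` — `N` the level (= conductor) binder of the newform.
Rows: BDV22 Thm. 3.1 (25) unit `A` = KLZ17's `Γ₁(N_f)`-Petersson (KLZ17 Thm. 2.7.4 / Thm. 10.2.2); BDV22 (30) carries it to `k_o`.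
[cite: BertoliniDarmonVenerucci2022, Thm. 3.1 (25) and (30), p. 31 and p. 36] [cite: KingsLoefflerZerbes2017, Thm. 2.7.4, p. 12] -/
def bdvExplicitExponentR (p : ℕ) (ap c : ℤ) (s : ℚ) (k : ℤ) (rf m : ℕ) (v : ℤ) (N : ℕ) : ℤ :=
  1 - padicValInt p ((p : ℤ) + 1 - ap) + padicValInt p c - padicValRat p s - padicValInt p k -
    ((padicValNat p rf : ℤ) - padicValNat p m) - (padicValNat p (Nat.totient N) : ℤ) - v

/-- `bdvExplicitExponentR = bdvExplicitExponent − ν_p(N)` (the rev ≤ 1.2 body, now a lemma). -/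
theorem bdvExplicitExponentR_eq_sub (p : ℕ) (ap c : ℤ) (s : ℚ) (k : ℤ) (rf m : ℕ) (v : ℤ) (N : ℕ) :
    bdvExplicitExponentR p ap c s k rf m v N = bdvExplicitExponent p ap c s k rf m v - (petIndexVal p N : ℤ) := by
  simp only [bdvExplicitExponentR, bdvExplicitExponent, petIndexVal]
  ring

/-- On the sub-class `p ∤ φ(N)` (no bad prime `q ≡ 1 (mod p)`; option (β) of the memo) the amendment vanishes. -/
theorem bdvExplicitExponentR_eq_of_not_dvd (p : ℕ) (ap c : ℤ) (s : ℚ) (k : ℤ) (rf m : ℕ) (v : ℤ) (N : ℕ)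
    (hN : ¬ p ∣ Nat.totient N) :
    bdvExplicitExponentR p ap c s k rf m v N = bdvExplicitExponent p ap c s k rf m v := by
  rw [bdvExplicitExponentR_eq_sub, petIndexVal, padicValNat.eq_zero_of_not_dvd hN]
  simp

/-- The `Γ₁`-reading: booking `r_f · φ(N)` (a stand-in for the `Γ₁(N)`-congruence number up to `p`-units, `p ≥ 5`)
in place of `r_f` in the registered exponent IS the amended exponent. -/
theorem bdvExplicitExponent_gamma1_reading (p : ℕ) [hp : Fact p.Prime] (ap c : ℤ) (s : ℚ) (k : ℤ)
    (rf m : ℕ) (v : ℤ) (N : ℕ) (hrf : rf ≠ 0) (hφ : Nat.totient N ≠ 0) :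
    bdvExplicitExponent p ap c s k (rf * Nat.totient N) m v = bdvExplicitExponentR p ap c s k rf m v N := by
  simp only [bdvExplicitExponentR, bdvExplicitExponent, padicValNat.mul hrf hφ]
  push_cast
  ring

/-- The column-difference form (P-T0)′ of the memo, as pure bookkeeping: for two parameter tuples the amended
exponents differ from the registered ones by exactly `−(ν_p(N) − ν_p(N'))`. -/
theorem bdvExplicitExponentR_sub (p : ℕ) (ap ap' c c' : ℤ) (s s' : ℚ) (k k' : ℤ) (rf rf' m m' : ℕ)
    (v v' : ℤ) (N N' : ℕ) :
    bdvExplicitExponentR p ap c s k rf m v N - bdvExplicitExponentR p ap' c' s' k' rf' m' v' N' =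
      (bdvExplicitExponent p ap c s k rf m v - bdvExplicitExponent p ap' c' s' k' rf' m' v') -
        ((petIndexVal p N : ℤ) - petIndexVal p N') := by
  simp only [bdvExplicitExponentR_eq_sub]
  ring

/-- Sanity numerals for the memo's test recipe (C3): `N = 5·11`, `p = 5`: `φ(55) = 40`, `ν_5 = 1`;
`N = 5·7`, `p = 5`: `φ(35) = 24`, `ν_5 = 0`. -/
example : petIndexVal 5 55 = 1 ∧ petIndexVal 5 35 = 0 := by native_decide

end Summit.BirchSwinnertonDyer.BirchSwinnertonDyer.Cruxes.EulerHalfNotRamNoInertSetAtFive.S1RSketch
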